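import Summits.BirchSwinnertonDyer.BirchSwinnertonDyer.Theorems.SmallImageMuTransferMuTransferX9StepTwoElementKernels
import Summits.BirchSwinnertonDyer.BirchSwinnertonDyer.Theorems.SmallImageMuTransferMuTransferX9LocalTransverse
import HarnessLib

/-!
# Step 2 of the `μ`-transfer core (`stub_coreX9`, crux 19276 `MuTransferX9`) AT THE DISTINGUISHED
# LOCAL FROBENIUS: every local Frobenius of `ℚ_v` is `E`-split of depth `n` and carries a
# `Γ_ℚ`-TRANSLATE of the prescribed joint value

Cell `b2b-bsdres` (X9 prover lineage, GEN 44) serving the K6 route `SmallImageMuTransfer` of cell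
`bsd-smallim`. HONEST FRAMING: the cell deletes COMBINATION-SHAPED residual classes of the rank-≤1
BSD formula from PUBLISHED theorems only and TYPES the construction-shaped remainder; this is not
"finishing BSD"; class X9 stays TYPED at class level. `--supports` helper toward `stub_coreX9` of
stmt-BirchSwinnertonDyer-19276; books nothing, closes nothing; theorems only (no definition, no
named fact).

Sequel of `…X9StepTwoElementKernels.lean` (p443767 §7, STEP 2 end-to-end: for every joint value
`w = (x, x^*) ∈ M = (φ, ψ)(H)` on k6-c2's joint kernel `H = N_J(κ) ⊓ N_{J'}(κ⁻¹)` and every finite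
`S`, an open normal `N ≤ H ⊓ Gal(ℚ̄/ℚ_{n+1})` killed by `φ`, `ψ` and a place `v ∉ S` unramified for
`N` with an arithmetic Frobenius `Fr ∈ H` AT SOME PRIME `𝔓 ∣ v` such that `(φ Fr, ψ Fr) = w`,
`ρ̄_{E,p}(Fr) = 1`, `Fr ∈ Gal(ℚ̄/ℚ_n) ∖ Gal(ℚ̄/ℚ_{n+1})`).

THE SEAM this file closes.  The local theory of STEPS 3–4 (koly's `…X9LocalTransverse` /
`…X9LocalSplitPrime` / the `q`-term of Lemma 1 (iii); the localisation maps `GaloisRep.toLocal v`;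
the Poitou–Tate local terms) lives on the completion `ℚ_v` with the tree's FIXED embedding
`absGaloisRestrict ℚ ℚ_v : Γ_{ℚ_v} → Γ_ℚ`, whose decomposition group is that of the DISTINGUISHED
prime `𝔓₀ = adicCompletionPrime ℚ v` (`decompositionSubgroup_adicCompletionPrime_eq_range`), while
Chebotarev (`exists_isArithFrobAt_mul_inv_mem_not_mem`) only prescribes the Frobenius CLASS of `v`,
i.e. a Frobenius at SOME `𝔓 = t • 𝔓₀`.  For every local Frobenius `Fr_v` of `ℚ_v` one has
`res Fr_v ∈ t⁻¹·Fr·t·N` (§2: transitivity of `Γ_ℚ` on `v.primesAbove`, `IsArithFrobAt.conj`,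
`IsArithFrobAt.mul_inv_mem_inertia`, inertia `≤ N`), hence — `φ|_N = ψ|_N = 0` and
`φ(t⁻¹ τ t) = t⁻¹·φ(τ)` for `τ ∈ H` (k6-c2 `contOneCocycles.apply_conj_of_fixed`) — its joint value
is the TRANSLATE `(φ (res Fr_v), ψ (res Fr_v)) = (t⁻¹·x, t⁻¹·x^*)`, again in `M`
(`smul_mem_jointValueSubgroup`), NOT `w` itself; no choice of `v` repairs this (the distinguished
Frobenius is an uncontrolled element of the class and `w` is not `Γ_ℚ`-fixed).  MU-TRANSFER-PROOF §5
STEP 2 says exactly this: "Another `𝔔` conjugates the pair by some `g ∈ G` and multiplies `⟨·,·⟩` by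
`ω(g) ≠ 0`: `ν` depends on `q` only" — so the assembly must carry the translate and use the
equivariance `⟨g x, g x^*⟩ = ω(g)·⟨x, x^*⟩` (k6-ty `gorensteinPairing_twistModP_smul`) to see that
Lemma 4's valuation `ν ≤ 1` is unchanged.

* §1 (generic, any `TopRep`): `φ(t⁻¹ τ t) = t⁻¹·φ(τ)` for `τ` acting trivially.
* §2 (generic, any number field `K`): for `N` unramified at `v`, a prime `𝔓 ∣ v` and an arithmetic
  Frobenius `Fr` at `𝔓`, there is `t ∈ Γ_K` with `t·(res Fr_v)·t⁻¹·Fr⁻¹ ∈ N` for EVERY local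
  arithmetic Frobenius `Fr_v ∈ Γ_{K_v}` (`exists_forall_isAbsArithFrob_conj_mul_inv_mem`).
* §3 (ℚ, `p` odd, `E[p]` irreducible, `ρ̄_{E,p}` not onto — X9 and X10b∧¬Surj):
  **`exists_forall_isAbsArithFrob_mem_inf_ker_apply_eq_smul_and_depth_of_ne_two`** — for every
  `w ∈ M` and finite `S`: `N` as in §7 of the parent file, `v ∉ S` unramified for `N` AND for `E[p]`
  (`GaloisRep.IsUnramifiedAt v (W.torsionGaloisModule p)`, free: inertia `≤ N ≤ H ≤ ker ρ̄`), and
  `t ∈ Γ_ℚ` with `t•w ∈ M` such that EVERY local Frobenius `Fr_v` of `ℚ_v` satisfies: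
  `res Fr_v ∈ H`, `(φ (res Fr_v), ψ (res Fr_v)) = t•w`, `ρ̄_{E,p}(res Fr_v) = 1` (in both spellings
  `galoisRepTorsion W p _ = 1` and `W.torsionGaloisModule p _ = 1` = koly's `hsplit`),
  `res Fr_v ∈ Gal(ℚ̄/ℚ_n) ∖ Gal(ℚ̄/ℚ_{n+1})` (koly's `hφm`/`hφm'`; `IsFrobPow Fr_v 1` from
  `IsAbsArithFrob.isFrobPow_holds`).
* §4 the `ClassX9` form (`p ≥ 5`).

PARTITION (D-0054): X9 (A4) · X10∧¬Surj (A5) at `p = 3` — hypothesis-discharging helper toward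
`stub_coreX9`; closes NONE.

References: J.-P. Serre, *Local Fields*, I §8 and VII §5 [SerreLocalFields1979]; J. Neukirch,
*Algebraic Number Theory*, I §9 Prop. (9.1), II §9 Prop. (9.6) [NeukirchANT1999]; J. Tate, *Global
class field theory*, Cassels–Fröhlich (1967) VII §2.4 [TateGCFT1967]; J.-P. Serre, Invent. Math. 15
(1972) §2.4 Prop. 15, §2.6 [Serre1972]; C.-H. Sah, J. Algebra 10 (1968) Prop. 2.7 (b) [Sah1968];
L. Washington, *Cyclotomic Fields*, §13.1–§13.2 [Washington1997]; HOME/koly/MU-TRANSFER-PROOF.md §5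
STEP 2 ("Another `𝔔` conjugates the pair …").
-/

-- the summit and its single problem are both named `BirchSwinnertonDyer` (registry layout D-0017)
set_option linter.dupNamespace false

set_option autoImplicit false

noncomputable section

open scoped NumberField
open Field WeierstrassCurve Literature.NumberTheory.EllipticCurves
  Literature.NumberTheory.GaloisRepresentations Function IsDedekindDomain NumberField
open Literature.NumberTheory.GaloisRepresentations.IsNonarchimedeanLocalField
open Literature.NumberTheory.Automorphic

namespace Summit.BirchSwinnertonDyer.BirchSwinnertonDyer.Rank1Residual

/-! ### §1 Generic: the value of a cocycle at `t⁻¹ τ t` -/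

namespace JointValue

universe u v

variable {R : Type u} [Ring R] [TopologicalSpace R]
variable {G : Type v} [Group G] [TopologicalSpace G]
variable {X : TopRep.{v} R G}

/-- `φ(t⁻¹ τ t) = t⁻¹·φ(τ)` when `τ` acts trivially (k6-c2's `apply_conj_of_fixed` at `σ = t⁻¹`): the
joint value at a Frobenius of the distinguished prime `𝔓₀ = t⁻¹ • 𝔓` is the `t⁻¹`-translate of the
joint value at `𝔓`. [cite: SerreLocalFields1979, VII §5 Prop. 3] -/
theorem apply_inv_mul_mul_of_fixed (φ : contOneCocycles X) {τ : G} (hτ : ∀ x : X, X.ρ τ x = x)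
    (t : G) : φ.1 (t⁻¹ * τ * t) = X.ρ t⁻¹ (φ.1 τ) := by
  have h := contOneCocycles.apply_conj_of_fixed φ hτ t⁻¹
  rwa [inv_inv] at h

end JointValue

/-! ### §2 Generic over a number field: from a Frobenius at `𝔓 ∣ v` to every local Frobenius of `K_v` -/

section NumberField

universe u

variable {K : Type u} [Field K] [NumberField K]

/-- **Frobenius transport to the distinguished prime.**  Let `N ≤ Γ_K` be unramified at the finite
place `v` (every inertia group above `v` lies in `N`), `𝔓 ∣ v` a prime of `\bar ℤ_K` and `Fr ∈ Γ_K`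
an arithmetic Frobenius at `𝔓` (Chebotarev's output).  Then there is `t ∈ Γ_K` (`t • 𝔓₀ = 𝔓`,
`𝔓₀ = adicCompletionPrime K v` the prime of the fixed embedding `K̄ → \bar K_v`) such that for EVERY
arithmetic Frobenius `Fr_v` of the local field `K_v`, `t·(res Fr_v)·t⁻¹·Fr⁻¹ ∈ N`: `res Fr_v` is a
Frobenius at `𝔓₀`, its `t`-conjugate one at `𝔓`, and two Frobenii at `𝔓` differ by inertia.
[cite: NeukirchANT1999, Ch. I §9 Prop. (9.1) and Ch. II §9 Prop. (9.6)]
[cite: SerreLocalFields1979, Ch. I §8] -/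
theorem exists_forall_isAbsArithFrob_conj_mul_inv_mem (N : Subgroup (absoluteGaloisGroup K))
    {v : HeightOneSpectrum (𝓞 K)} (hunr : SubgroupIsUnramifiedAt K N v)
    {𝔓 : Ideal (absIntegers (𝓞 K) K)} (h𝔓 : 𝔓 ∈ v.primesAbove) {Fr : absoluteGaloisGroup K}
    (hFr : IsArithFrobAt (𝓞 K) Fr 𝔓) :
    ∃ t : absoluteGaloisGroup K, ∀ Frv : absoluteGaloisGroup (v.adicCompletion K),
      IsAbsArithFrob Frv →
        t * absGaloisRestrict K (v.adicCompletion K) Frv * t⁻¹ * Fr⁻¹ ∈ N := by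
  classical
  haveI : 𝔓.IsPrime := h𝔓.1
  obtain ⟨t, ht⟩ := HeightOneSpectrum.exists_smul_eq_of_mem_primesAbove_holds
    (adicCompletionPrime_mem_primesAbove K v) h𝔓
  refine ⟨t, fun Frv hFrv => ?_⟩
  have hres : IsArithFrobAt (𝓞 K) (absGaloisRestrict K (v.adicCompletion K) Frv)
      (adicCompletionPrime K v) :=
    (isArithFrobAt_absGaloisRestrict_adicCompletionPrime_iff K v
      (by rw [residueFieldCard_adicCompletion_eq K v, HeightOneSpectrum.residueCard_eq_card_quotient])
      Frv).2 hFrv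
  have hconj : IsArithFrobAt (𝓞 K) (t * absGaloisRestrict K (v.adicCompletion K) Frv * t⁻¹) 𝔓 :=
    ht ▸ hres.conj t
  exact hunr 𝔓 h𝔓 (hconj.mul_inv_mem_inertia hFr)

end NumberField

/-! ### §3 Over `ℚ`: STEP 2 at the distinguished local Frobenius of `ℚ_v` -/

section RatLocal

variable (W : WeierstrassCurve ℚ) [W.IsElliptic] (p : ℕ) [Fact p.Prime] (κ : ZpExtension ℚ p)

/-- **MU-TRANSFER-PROOF §5 STEP 2 at the DISTINGUISHED local Frobenius** (`p` odd, `E[p]`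
irreducible, `ρ̄_{E,p}` not onto; `H = N_J(κ) ⊓ N_{J'}(κ⁻¹)` k6-c2's joint kernel, `1 ≤ J ≤ pⁿ`,
`J' ≤ pⁿ`).  For every joint value `w = (x, x^*) ∈ M = (φ, ψ)(H)` and every finite set `S` of finite
places of `ℚ` there are: an open normal subgroup `N ≤ H ⊓ Gal(ℚ̄/ℚ_{n+1})` killed by `φ` and `ψ`
(«`Gal(ℚ̄/L')`»); a place `v ∉ S` unramified for `N` — hence unramified for `E[p]`
(`GaloisRep.IsUnramifiedAt v (W.torsionGaloisModule p)`: inertia `≤ N ≤ H ≤ ker ρ̄`) —; and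
`t ∈ Γ_ℚ` with `t•w = (t·x, t·x^*) ∈ M`, such that EVERY arithmetic Frobenius `Fr_v` of the local
field `ℚ_v` (restricted along the tree's fixed embedding `absGaloisRestrict ℚ ℚ_v`, the one seen by
`GaloisRep.toLocal v`, the localisation maps and the Poitou–Tate local terms) satisfies:
`res Fr_v ∈ H`, `(φ (res Fr_v), ψ (res Fr_v)) = t•w`, `ρ̄_{E,p}(res Fr_v) = 1` (both spellings:
`v` is `E`-split, koly's `hsplit`), `res Fr_v ∈ Gal(ℚ̄/ℚ_n) ∖ Gal(ℚ̄/ℚ_{n+1})` (depth exactly `n`: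
`e_q = pⁿ = e`, koly's `hφm`/`hφm'`).  The joint value is a TRANSLATE of `w`, not `w`: see the
module docstring; Lemma 4's valuation is translation-invariant by `⟨g x, g x^*⟩ = ω(g)⟨x, x^*⟩`.
[cite: TateGCFT1967, §2.4 (Tchebotarev density theorem) with Prop. 2.3]
[cite: NeukirchANT1999, Ch. I §9 Prop. (9.1) and Ch. II §9 Prop. (9.6)]
[cite: SerreLocalFields1979, Ch. I §8 and VII §5 Prop. 3] [cite: Serre1972, §2.4 Prop. 15 and §2.6]
[cite: Sah1968, Prop. 2.7 (b)] [cite: Washington1997, §13.1–§13.2] -/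
theorem exists_forall_isAbsArithFrob_mem_inf_ker_apply_eq_smul_and_depth_of_ne_two (hp2 : p ≠ 2)
    (hirr : W.HasIrreducibleModPGaloisRep p) (hns : ¬ W.HasSurjectiveModNGaloisRep p)
    {J J' n : ℕ} (hJ0 : 0 < J) (hJ : J ≤ p ^ n) (hJ' : J' ≤ p ^ n)
    (φ : contOneCocycles (W.modPTwist p κ J).toTopRep)
    (ψ : contOneCocycles (W.modPTwist p κ.invTwist J').toTopRep)
    {w : (W.modPTwist p κ J).toTopRep × (W.modPTwist p κ.invTwist J').toTopRep}
    (hw : w ∈ contOneCocycles.jointValueSubgroup φ ψ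
      ((κ.twistModPRepresentation (W.torsionGaloisModule (p : ℤ))
          (fun P : geomTorsion W (p : ℤ) => AddSubgroup.torsionBy.nsmul P) J).ker ⊓
        (κ.invTwist.twistModPRepresentation (W.torsionGaloisModule (p : ℤ))
          (fun P : geomTorsion W (p : ℤ) => AddSubgroup.torsionBy.nsmul P) J').ker)
      (fun _ hτ x => κ.toTopRep_ρ_apply_eq_self_of_mem_ker (W.torsionGaloisModule (p : ℤ)) _ J
        (Subgroup.mem_inf.mp hτ).1 x)
      (fun _ hτ y => κ.invTwist.toTopRep_ρ_apply_eq_self_of_mem_ker (W.torsionGaloisModule (p : ℤ))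
        _ J' (Subgroup.mem_inf.mp hτ).2 y))
    (S : Set (HeightOneSpectrum (𝓞 ℚ))) (hS : S.Finite) :
    ∃ N : Subgroup (absoluteGaloisGroup ℚ), N.Normal ∧ IsOpen (N : Set (absoluteGaloisGroup ℚ)) ∧
      N ≤ (κ.twistModPRepresentation (W.torsionGaloisModule (p : ℤ))
          (fun P : geomTorsion W (p : ℤ) => AddSubgroup.torsionBy.nsmul P) J).ker ⊓
        (κ.invTwist.twistModPRepresentation (W.torsionGaloisModule (p : ℤ))
          (fun P : geomTorsion W (p : ℤ) => AddSubgroup.torsionBy.nsmul P) J').ker ∧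
      N ≤ κ.layerSubgroup (n + 1) ∧ (∀ σ ∈ N, φ.1 σ = 0) ∧ (∀ σ ∈ N, ψ.1 σ = 0) ∧
      ∃ v ∉ S, SubgroupIsUnramifiedAt ℚ N v ∧
        GaloisRep.IsUnramifiedAt v (W.torsionGaloisModule (p : ℤ)) ∧
        ∃ t : absoluteGaloisGroup ℚ,
          ((W.modPTwist p κ J).toTopRep.ρ t w.1, (W.modPTwist p κ.invTwist J').toTopRep.ρ t w.2) ∈
              contOneCocycles.jointValueSubgroup φ ψ
                ((κ.twistModPRepresentation (W.torsionGaloisModule (p : ℤ))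
                    (fun P : geomTorsion W (p : ℤ) => AddSubgroup.torsionBy.nsmul P) J).ker ⊓
                  (κ.invTwist.twistModPRepresentation (W.torsionGaloisModule (p : ℤ))
                    (fun P : geomTorsion W (p : ℤ) => AddSubgroup.torsionBy.nsmul P) J').ker)
                (fun _ hτ x => κ.toTopRep_ρ_apply_eq_self_of_mem_ker (W.torsionGaloisModule (p : ℤ))
                  _ J (Subgroup.mem_inf.mp hτ).1 x)
                (fun _ hτ y => κ.invTwist.toTopRep_ρ_apply_eq_self_of_mem_ker
                  (W.torsionGaloisModule (p : ℤ)) _ J' (Subgroup.mem_inf.mp hτ).2 y) ∧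
          ∀ Frv : absoluteGaloisGroup (v.adicCompletion ℚ), IsAbsArithFrob Frv →
            absGaloisRestrict ℚ (v.adicCompletion ℚ) Frv ∈
                (κ.twistModPRepresentation (W.torsionGaloisModule (p : ℤ))
                    (fun P : geomTorsion W (p : ℤ) => AddSubgroup.torsionBy.nsmul P) J).ker ⊓
                  (κ.invTwist.twistModPRepresentation (W.torsionGaloisModule (p : ℤ))
                    (fun P : geomTorsion W (p : ℤ) => AddSubgroup.torsionBy.nsmul P) J').ker ∧
              φ.1 (absGaloisRestrict ℚ (v.adicCompletion ℚ) Frv) =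
                (W.modPTwist p κ J).toTopRep.ρ t w.1 ∧
              ψ.1 (absGaloisRestrict ℚ (v.adicCompletion ℚ) Frv) =
                (W.modPTwist p κ.invTwist J').toTopRep.ρ t w.2 ∧
              galoisRepTorsion W p (absGaloisRestrict ℚ (v.adicCompletion ℚ) Frv) = 1 ∧
              W.torsionGaloisModule (p : ℤ) (absGaloisRestrict ℚ (v.adicCompletion ℚ) Frv) = 1 ∧
              absGaloisRestrict ℚ (v.adicCompletion ℚ) Frv ∈ κ.layerSubgroup n ∧
              absGaloisRestrict ℚ (v.adicCompletion ℚ) Frv ∉ κ.layerSubgroup (n + 1) := by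
  -- STEP 2 end-to-end at SOME prime `𝔓 ∣ v` (parent file §7)
  obtain ⟨N, hNn, hNo, hNH, hNL, hNφ, hNψ, v, hvS, hunr, 𝔓, h𝔓, Fr, hFr, hFrH, hφFr, hψFr, -,
      hFrn, hFrn1⟩ :=
    exists_isArithFrobAt_mem_inf_ker_apply_eq_and_depth_of_ne_two W p κ hp2 hirr hns hJ0 hJ hJ' φ ψ
      hw S hS
  haveI := hNn
  -- the two modules are fixed by `H`
  have hX : ∀ τ ∈ (κ.twistModPRepresentation (W.torsionGaloisModule (p : ℤ))
          (fun P : geomTorsion W (p : ℤ) => AddSubgroup.torsionBy.nsmul P) J).ker ⊓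
        (κ.invTwist.twistModPRepresentation (W.torsionGaloisModule (p : ℤ))
          (fun P : geomTorsion W (p : ℤ) => AddSubgroup.torsionBy.nsmul P) J').ker,
      ∀ x : (W.modPTwist p κ J).toTopRep, (W.modPTwist p κ J).toTopRep.ρ τ x = x :=
    fun _ hτ x => κ.toTopRep_ρ_apply_eq_self_of_mem_ker (W.torsionGaloisModule (p : ℤ)) _ J
      (Subgroup.mem_inf.mp hτ).1 x
  have hY : ∀ τ ∈ (κ.twistModPRepresentation (W.torsionGaloisModule (p : ℤ))
          (fun P : geomTorsion W (p : ℤ) => AddSubgroup.torsionBy.nsmul P) J).ker ⊓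
        (κ.invTwist.twistModPRepresentation (W.torsionGaloisModule (p : ℤ))
          (fun P : geomTorsion W (p : ℤ) => AddSubgroup.torsionBy.nsmul P) J').ker,
      ∀ y : (W.modPTwist p κ.invTwist J').toTopRep,
        (W.modPTwist p κ.invTwist J').toTopRep.ρ τ y = y :=
    fun _ hτ y => κ.invTwist.toTopRep_ρ_apply_eq_self_of_mem_ker (W.torsionGaloisModule (p : ℤ))
      _ J' (Subgroup.mem_inf.mp hτ).2 y
  -- `H ≤ ker ρ̄` (`J ≥ 1`)
  have hHρ : (κ.twistModPRepresentation (W.torsionGaloisModule (p : ℤ))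
          (fun P : geomTorsion W (p : ℤ) => AddSubgroup.torsionBy.nsmul P) J).ker ⊓
        (κ.invTwist.twistModPRepresentation (W.torsionGaloisModule (p : ℤ))
          (fun P : geomTorsion W (p : ℤ) => AddSubgroup.torsionBy.nsmul P) J').ker ≤
      (galoisRepTorsion W p).ker :=
    inf_le_left.trans (ker_twistModPRepresentation_le_ker W p κ hJ0)
  -- Frobenius transport to the distinguished prime of `v`
  obtain ⟨t, ht⟩ := exists_forall_isAbsArithFrob_conj_mul_inv_mem N hunr h𝔓 hFr
  refine ⟨N, hNn, hNo, hNH, hNL, hNφ, hNψ, v, hvS, hunr, ?_, t⁻¹, ?_, fun Frv hFrv => ?_⟩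
  · -- `E[p]` is unramified at `v`: inertia `≤ N ≤ H ≤ ker ρ̄`
    intro 𝔔 h𝔔 σ hσ
    have h1 : galoisRepTorsion W p σ = 1 := MonoidHom.mem_ker.mp (hHρ (hNH (hunr 𝔔 h𝔔 hσ)))
    exact LinearMap.ext fun P => by
      rw [torsionGaloisModule_apply_apply]
      exact forall_smul_eq_of_galoisRepTorsion_eq_one W p h1 P
  · -- the translate lies in `M`
    exact contOneCocycles.smul_mem_jointValueSubgroup φ ψ _ hX hY t⁻¹ hw
  · -- every local Frobenius: `t·(res Fr_v)·t⁻¹ ∈ Fr·N`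
    have hτN : t * absGaloisRestrict ℚ (v.adicCompletion ℚ) Frv * t⁻¹ * Fr⁻¹ ∈ N := ht Frv hFrv
    obtain ⟨hτH, hφτ⟩ := JointValue.mem_and_apply_eq_of_mul_inv_mem φ _ hX hNH hNφ hFrH hτN
    obtain ⟨-, hψτ⟩ := JointValue.mem_and_apply_eq_of_mul_inv_mem ψ _ hY hNH hNψ hFrH hτN
    have hconj : t⁻¹ * (t * absGaloisRestrict ℚ (v.adicCompletion ℚ) Frv * t⁻¹) * t =
        absGaloisRestrict ℚ (v.adicCompletion ℚ) Frv := by group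
    have hrH : absGaloisRestrict ℚ (v.adicCompletion ℚ) Frv ∈
        (κ.twistModPRepresentation (W.torsionGaloisModule (p : ℤ))
            (fun P : geomTorsion W (p : ℤ) => AddSubgroup.torsionBy.nsmul P) J).ker ⊓
          (κ.invTwist.twistModPRepresentation (W.torsionGaloisModule (p : ℤ))
            (fun P : geomTorsion W (p : ℤ) => AddSubgroup.torsionBy.nsmul P) J').ker := by
      have h := Subgroup.Normal.conj_mem inferInstance _ hτH t⁻¹
      rwa [inv_inv, hconj] at h
    have hρr : galoisRepTorsion W p (absGaloisRestrict ℚ (v.adicCompletion ℚ) Frv) = 1 :=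
      MonoidHom.mem_ker.mp (hHρ hrH)
    -- depth: membership in the layers is constant on `Fr·N` (`N ≤ Γ_{n+1} ≤ Γ_n`) and conjugation invariant
    have hτn : t * absGaloisRestrict ℚ (v.adicCompletion ℚ) Frv * t⁻¹ ∈ κ.layerSubgroup n :=
      (JointValue.mem_iff_mem_of_mul_inv_mem
        (hNL.trans (κ.layerSubgroup_antitone (Nat.le_succ n))) hτN).mpr hFrn
    have hτn1 : t * absGaloisRestrict ℚ (v.adicCompletion ℚ) Frv * t⁻¹ ∉ κ.layerSubgroup (n + 1) :=
      fun h => hFrn1 ((JointValue.mem_iff_mem_of_mul_inv_mem hNL hτN).mp h)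
    refine ⟨hrH, ?_, ?_, hρr, ?_, ?_, ?_⟩
    · rw [← hconj, JointValue.apply_inv_mul_mul_of_fixed φ (hX _ hτH) t, hφτ, hφFr]
    · rw [← hconj, JointValue.apply_inv_mul_mul_of_fixed ψ (hY _ hτH) t, hψτ, hψFr]
    · exact LinearMap.ext fun P => by
        rw [torsionGaloisModule_apply_apply]
        exact forall_smul_eq_of_galoisRepTorsion_eq_one W p hρr P
    · have h := Subgroup.Normal.conj_mem inferInstance _ hτn t⁻¹
      rwa [inv_inv, hconj] at h
    · intro h
      exact hτn1 (Subgroup.Normal.conj_mem inferInstance _ h t)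

end RatLocal

/-! ### §4 Class X9 -/

section ClassX9

variable (W : WeierstrassCurve ℚ) [W.IsElliptic] [W.IsGloballyMinimal] (p : ℕ) [Fact p.Prime]
  (κ : ZpExtension ℚ p)

/-- **On class X9: STEP 2 at the distinguished local Frobenius** (`1 ≤ J ≤ pⁿ`, `J' ≤ pⁿ`): for every
joint value `w` on the joint kernel `N_J(κ) ⊓ N_{J'}(κ⁻¹)` and every finite `S`, a place `v ∉ S`,
unramified for the governing subgroup and for `E[p]`, and `t ∈ Γ_ℚ` with `t•w ∈ M`, such that every
local Frobenius of `ℚ_v` lies in the joint kernel, is `E`-split of depth exactly `n`, and has joint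
value `t•w`. [cite: TateGCFT1967, §2.4 (Tchebotarev density theorem) with Prop. 2.3]
[cite: NeukirchANT1999, Ch. II §9 Prop. (9.6)] [cite: Serre1972, §2.4 Prop. 15 and §2.6]
[cite: Sah1968, Prop. 2.7 (b)] [cite: Washington1997, §13.1–§13.2] -/
theorem ClassX9.exists_forall_isAbsArithFrob_mem_inf_ker_apply_eq_smul_and_depth (h : ClassX9 W p)
    {J J' n : ℕ} (hJ0 : 0 < J) (hJ : J ≤ p ^ n) (hJ' : J' ≤ p ^ n)
    (φ : contOneCocycles (W.modPTwist p κ J).toTopRep)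
    (ψ : contOneCocycles (W.modPTwist p κ.invTwist J').toTopRep)
    {w : (W.modPTwist p κ J).toTopRep × (W.modPTwist p κ.invTwist J').toTopRep}
    (hw : w ∈ contOneCocycles.jointValueSubgroup φ ψ
      ((κ.twistModPRepresentation (W.torsionGaloisModule (p : ℤ))
          (fun P : geomTorsion W (p : ℤ) => AddSubgroup.torsionBy.nsmul P) J).ker ⊓
        (κ.invTwist.twistModPRepresentation (W.torsionGaloisModule (p : ℤ))
          (fun P : geomTorsion W (p : ℤ) => AddSubgroup.torsionBy.nsmul P) J').ker)
      (fun _ hτ x => κ.toTopRep_ρ_apply_eq_self_of_mem_ker (W.torsionGaloisModule (p : ℤ)) _ J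
        (Subgroup.mem_inf.mp hτ).1 x)
      (fun _ hτ y => κ.invTwist.toTopRep_ρ_apply_eq_self_of_mem_ker (W.torsionGaloisModule (p : ℤ))
        _ J' (Subgroup.mem_inf.mp hτ).2 y))
    (S : Set (HeightOneSpectrum (𝓞 ℚ))) (hS : S.Finite) :
    ∃ N : Subgroup (absoluteGaloisGroup ℚ), N.Normal ∧ IsOpen (N : Set (absoluteGaloisGroup ℚ)) ∧
      N ≤ (κ.twistModPRepresentation (W.torsionGaloisModule (p : ℤ))
          (fun P : geomTorsion W (p : ℤ) => AddSubgroup.torsionBy.nsmul P) J).ker ⊓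
        (κ.invTwist.twistModPRepresentation (W.torsionGaloisModule (p : ℤ))
          (fun P : geomTorsion W (p : ℤ) => AddSubgroup.torsionBy.nsmul P) J').ker ∧
      N ≤ κ.layerSubgroup (n + 1) ∧ (∀ σ ∈ N, φ.1 σ = 0) ∧ (∀ σ ∈ N, ψ.1 σ = 0) ∧
      ∃ v ∉ S, SubgroupIsUnramifiedAt ℚ N v ∧
        GaloisRep.IsUnramifiedAt v (W.torsionGaloisModule (p : ℤ)) ∧
        ∃ t : absoluteGaloisGroup ℚ,
          ((W.modPTwist p κ J).toTopRep.ρ t w.1, (W.modPTwist p κ.invTwist J').toTopRep.ρ t w.2) ∈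
              contOneCocycles.jointValueSubgroup φ ψ
                ((κ.twistModPRepresentation (W.torsionGaloisModule (p : ℤ))
                    (fun P : geomTorsion W (p : ℤ) => AddSubgroup.torsionBy.nsmul P) J).ker ⊓
                  (κ.invTwist.twistModPRepresentation (W.torsionGaloisModule (p : ℤ))
                    (fun P : geomTorsion W (p : ℤ) => AddSubgroup.torsionBy.nsmul P) J').ker)
                (fun _ hτ x => κ.toTopRep_ρ_apply_eq_self_of_mem_ker (W.torsionGaloisModule (p : ℤ))
                  _ J (Subgroup.mem_inf.mp hτ).1 x)
                (fun _ hτ y => κ.invTwist.toTopRep_ρ_apply_eq_self_of_mem_ker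
                  (W.torsionGaloisModule (p : ℤ)) _ J' (Subgroup.mem_inf.mp hτ).2 y) ∧
          ∀ Frv : absoluteGaloisGroup (v.adicCompletion ℚ), IsAbsArithFrob Frv →
            absGaloisRestrict ℚ (v.adicCompletion ℚ) Frv ∈
                (κ.twistModPRepresentation (W.torsionGaloisModule (p : ℤ))
                    (fun P : geomTorsion W (p : ℤ) => AddSubgroup.torsionBy.nsmul P) J).ker ⊓
                  (κ.invTwist.twistModPRepresentation (W.torsionGaloisModule (p : ℤ))
                    (fun P : geomTorsion W (p : ℤ) => AddSubgroup.torsionBy.nsmul P) J').ker ∧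
              φ.1 (absGaloisRestrict ℚ (v.adicCompletion ℚ) Frv) =
                (W.modPTwist p κ J).toTopRep.ρ t w.1 ∧
              ψ.1 (absGaloisRestrict ℚ (v.adicCompletion ℚ) Frv) =
                (W.modPTwist p κ.invTwist J').toTopRep.ρ t w.2 ∧
              galoisRepTorsion W p (absGaloisRestrict ℚ (v.adicCompletion ℚ) Frv) = 1 ∧
              W.torsionGaloisModule (p : ℤ) (absGaloisRestrict ℚ (v.adicCompletion ℚ) Frv) = 1 ∧
              absGaloisRestrict ℚ (v.adicCompletion ℚ) Frv ∈ κ.layerSubgroup n ∧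
              absGaloisRestrict ℚ (v.adicCompletion ℚ) Frv ∉ κ.layerSubgroup (n + 1) :=
  exists_forall_isAbsArithFrob_mem_inf_ker_apply_eq_smul_and_depth_of_ne_two W p κ
    (by have := h.2.1; omega) h.2.2.2.2.1 h.2.2.2.2.2 hJ0 hJ hJ' φ ψ hw S hS

end ClassX9

end Summit.BirchSwinnertonDyer.BirchSwinnertonDyer.Rank1Residual

end
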